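import Mathlib
import HarnessLib
import Summits.ValiantsHypothesis.ValiantsHypothesis.Theses.MonotoneRestoration
import Literature.Computability.AlgebraicComplexity.RazElusiveGeneralRouteProofs

/-!
# Route MonotoneRestoration — the crux is implied by the target (`NonnegRestorationQP → MonotoneRestorationQP`)

Crux item `stmt-ValiantsHypothesis-15886`. Together with the PROVED support `CruxToTarget`
(`MonotoneRestorationQP → SensitiveBridge → DenseSubtraction → NonnegRestorationQP`, with
`SensitiveBridge` and `DenseSubtraction` proved) this records that the crux and the route target are
EQUIVALENT: a family of polynomial degree and polynomial MONOTONE complexity (tree `complexity` over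
the semiring `ℝ≥0`) is, after complexification, a VP family (a monotone circuit is a circuit:
`ArithCircuit.complexity_map_le`), so nonnegative restoration applies to it verbatim. The monotone
hypothesis is therefore logically removable from the crux; it is a proof STRATEGY, not a weakening.

Adapted from the crux-ideate scratch file `Cruxes/MonotoneRestorationQP/Sketch_ideator1.lean`
(planner-cruxidea, round 1, ideator 1), landed by the line lead.
-/

set_option linter.dupNamespace false

namespace Summit.ValiantsHypothesis.ValiantsHypothesis.Theorems

open Summit.ValiantsHypothesis.ValiantsHypothesis.Theses.MonotoneRestoration
open Literature.Computability.AlgebraicComplexity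

/-- Arithmetic: `(n + 2)^c ≤ n^(2c + 3^c) + (2c + 3^c)` for all `n, c` (the route's `(n+2)^c`
bounds dominate-ably rewritten in the `n^c' + c'` shape of `IsVPFamily`). [folklore] -/
theorem targetImpliesCrux_pow_bound (n c : ℕ) :
    (n + 2) ^ c ≤ n ^ (2 * c + 3 ^ c) + (2 * c + 3 ^ c) := by
  rcases Nat.lt_or_ge n 2 with hn | hn
  · have h3 : (n + 2) ^ c ≤ 3 ^ c := Nat.pow_le_pow_left (by omega) c
    calc (n + 2) ^ c ≤ 3 ^ c := h3
      _ ≤ 2 * c + 3 ^ c := Nat.le_add_left _ _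
      _ ≤ n ^ (2 * c + 3 ^ c) + (2 * c + 3 ^ c) := Nat.le_add_left _ _
  · have h1 : n + 2 ≤ n * n := by nlinarith
    have hn1 : 1 ≤ n := by omega
    calc (n + 2) ^ c ≤ (n * n) ^ c := Nat.pow_le_pow_left h1 c
      _ = n ^ (2 * c) := by rw [← pow_two, ← pow_mul]
      _ ≤ n ^ (2 * c + 3 ^ c) := Nat.pow_le_pow_right hn1 (Nat.le_add_right _ _)
      _ ≤ n ^ (2 * c + 3 ^ c) + (2 * c + 3 ^ c) := Nat.le_add_right _ _

/-- **Target ⇒ crux.** `NonnegRestorationQP → MonotoneRestorationQP`: a matrix-symmetric family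
over `ℝ≥0` with `totalDegree ≤ (n+2)^c` and monotone complexity `≤ (n+2)^c` has a
complexification that is a VP family (`IsVPFamily`: `n²` variables, degree and complexity
`≤ n^c' + c'`, using `ArithCircuit.complexity_map_le` — mapping a circuit along a ring hom does
not increase size), so the target's conclusion is the crux's conclusion. With the proved
`CruxToTarget` the crux and the target are equivalent. [folklore] -/
theorem stub_target_implies_crux : NonnegRestorationQP → MonotoneRestorationQP := by
  intro hX f hsymm hmono
  obtain ⟨c, hc⟩ := hmono
  refine hX f hsymm ⟨⟨⟨2, fun n => ?_⟩, ⟨2 * c + 3 ^ c, fun n => ?_⟩⟩, ⟨2 * c + 3 ^ c, fun n => ?_⟩⟩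
  · simp only [Fintype.card_prod, Fintype.card_fin]
    nlinarith
  · calc (MvPolynomial.map (Complex.ofRealHom.comp NNReal.toRealHom) (f n)).totalDegree
        ≤ (f n).totalDegree := Finset.sup_mono (MvPolynomial.support_map_subset _ _)
      _ ≤ (n + 2) ^ c := (hc n).1
      _ ≤ n ^ (2 * c + 3 ^ c) + (2 * c + 3 ^ c) := targetImpliesCrux_pow_bound n c
  · calc complexity (MvPolynomial.map (Complex.ofRealHom.comp NNReal.toRealHom) (f n))
        ≤ complexity (f n) := ArithCircuit.complexity_map_le _ _
      _ ≤ (n + 2) ^ c := (hc n).2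
      _ ≤ n ^ (2 * c + 3 ^ c) + (2 * c + 3 ^ c) := targetImpliesCrux_pow_bound n c

/-- **The crux is equivalent to the target** of route MonotoneRestoration, given the two proved
supports it is glued through (`SensitiveBridge`, `DenseSubtraction`) and the proved glue
`CruxToTarget`. Stated with the supports as hypotheses because their proofs live in sibling
Theorems modules importing the route file. [folklore] -/
theorem monotoneRestorationQP_iff_target (h₂ : SensitiveBridge) (h₃ : DenseSubtraction)
    (h₄ : CruxToTarget) : MonotoneRestorationQP ↔ NonnegRestorationQP :=
  ⟨fun h₁ => h₄ h₁ h₂ h₃, stub_target_implies_crux⟩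

end Summit.ValiantsHypothesis.ValiantsHypothesis.Theorems
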